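import Mathlib.Probability.Process.Stopping
import Mathlib.Probability.Martingale.Basic
import HarnessLib

/-!
# Augmentation of a sub-σ-algebra (and of a filtration) by the null sets of a measure

Crux `Summit.CriticalPhenomena.CardyFormulaZ2.Theses.CardyUniqueLimit.CardyRigidity`
(stmt-CriticalPhenomena-0746), line `crossing_martingale`, stub `stub_slitCrossingData`, piece
(P-clock) `PercCapacityClock`: the capacity clock data ask for a filtration `𝒢` with a SURE
locality clause `Measurable[𝒢 n] ({u ≤ θ n}.indicator V_u)` for the discrete driving process
`V`, which is a class function of the exploration prefix only ALMOST surely (describability of the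
interface is not decided by a prefix).  The standard device (the "usual augmentation" of a
filtration, Kallenberg, *Foundations of Modern Probability* (2021), Lemma 9.8 ff.) is to enlarge
each `𝒢 n` by the `μ`-null measurable sets: conditional expectations do not change (so the
domain-Markov bridge `E[g | 𝒢 n] = percSlitExpectation … n g` a.e. survives), adaptedness and
stopping times are preserved, and every ambient-measurable function which is a.e. equal to a
`𝒢 n`-measurable one becomes measurable.  Generic measure theory:

* `Augment.nullSigma μ` — the σ-algebra generated by the measurable `μ`-null sets;
  `Augment.augment μ m₀ = m₀ ⊔ nullSigma μ`;
* `Augment.measurableSet_augment_iff` — **structure theorem**: for `m₀ ≤ m`, a set is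
  `augment μ m₀`-measurable iff it is measurable and differs from some `m₀`-set by a `μ`-null set;
* `Augment.condExp_augment_ae_eq` — `μ[g | augment μ m₀] =ᵐ[μ] μ[g | m₀]` (finite `μ`);
* `Augment.measurable_augment_of_ae_eq` — `f` measurable and `f =ᵐ[μ] g` with `g`
  `m₀`-measurable ⇒ `f` is `augment μ m₀`-measurable;
* `Augment.filtration` — the augmented filtration `n ↦ 𝒢 n ⊔ nullSigma μ`, with
  `adapted_filtration`, `isStoppingTime_filtration`, `measurable_filtration_of_ae_eq`,
  `condExp_filtration_ae_eq`.
-/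

noncomputable section

open MeasureTheory Filter Set
open scoped ENNReal symmDiff

namespace Summit.CriticalPhenomena.CardyFormulaZ2.Cruxes.CardyRigidity.CrossingMartingale

namespace Augment

variable {Ω : Type*} {m : MeasurableSpace Ω} (μ : Measure Ω)

/-- The σ-algebra generated by the measurable `μ`-null sets. [cite: Kallenberg2021, Lemma 9.8] -/
@[reducible] def nullSigma : MeasurableSpace Ω :=
  MeasurableSpace.generateFrom {s | MeasurableSet[m] s ∧ μ s = 0}

/-- The null σ-algebra is contained in the ambient one. [folklore] -/
theorem nullSigma_le : nullSigma μ ≤ m :=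
  MeasurableSpace.generateFrom_le fun _ hs ↦ hs.1

/-- **The augmentation** of the sub-σ-algebra `m₀` by the `μ`-null sets.
[cite: Kallenberg2021, Lemma 9.8] -/
@[reducible] def augment (m₀ : MeasurableSpace Ω) : MeasurableSpace Ω :=
  m₀ ⊔ nullSigma μ

/-- `m₀ ≤ augment μ m₀`. [folklore] -/
theorem le_augment (m₀ : MeasurableSpace Ω) : m₀ ≤ augment μ m₀ :=
  le_sup_left

/-- `augment μ m₀ ≤ m` when `m₀ ≤ m`. [folklore] -/
theorem augment_le {m₀ : MeasurableSpace Ω} (hm₀ : m₀ ≤ m) : augment μ m₀ ≤ m :=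
  sup_le hm₀ (nullSigma_le μ)

/-- `(⋃ fᵢ) ∆ (⋃ tᵢ) ⊆ ⋃ (fᵢ ∆ tᵢ)`. [folklore] -/
theorem iUnion_symmDiff_iUnion_subset (f t : ℕ → Set Ω) :
    (⋃ i, f i) ∆ (⋃ i, t i) ⊆ ⋃ i, f i ∆ t i := by
  intro x hx
  rcases hx with ⟨hx1, hx2⟩ | ⟨hx1, hx2⟩
  · obtain ⟨i, hi⟩ := mem_iUnion.1 hx1
    exact mem_iUnion.2 ⟨i, Or.inl ⟨hi, fun h ↦ hx2 (mem_iUnion.2 ⟨i, h⟩)⟩⟩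
  · obtain ⟨i, hi⟩ := mem_iUnion.1 hx1
    exact mem_iUnion.2 ⟨i, Or.inr ⟨hi, fun h ↦ hx2 (mem_iUnion.2 ⟨i, h⟩)⟩⟩

/-- The class of measurable sets differing from an `m₀`-set by a null set, as a σ-algebra.
[cite: Kallenberg2021, Lemma 9.8] -/
@[reducible] def almostSpace (m₀ : MeasurableSpace Ω) : MeasurableSpace Ω where
  MeasurableSet' s := MeasurableSet[m] s ∧ ∃ t, MeasurableSet[m₀] t ∧ μ (s ∆ t) = 0
  measurableSet_empty := ⟨@MeasurableSet.empty Ω m, ∅, @MeasurableSet.empty Ω m₀, by simp⟩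
  measurableSet_compl s hs := by
    obtain ⟨hs, t, ht, hst⟩ := hs
    exact ⟨hs.compl, tᶜ, ht.compl, by rwa [compl_symmDiff_compl]⟩
  measurableSet_iUnion f hf := by
    choose hf t ht hft using hf
    refine ⟨MeasurableSet.iUnion hf, ⋃ i, t i, MeasurableSet.iUnion ht, ?_⟩
    exact measure_mono_null (iUnion_symmDiff_iUnion_subset f t) (measure_iUnion_null_iff.2 hft)

/-- **Structure theorem of the augmentation.**  For `m₀ ≤ m`, a set is measurable for
`augment μ m₀ = m₀ ⊔ nullSigma μ` iff it is measurable and `μ (s ∆ t) = 0` for some `m₀`-set `t`.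
[cite: Kallenberg2021, Lemma 9.8] -/
theorem measurableSet_augment_iff {m₀ : MeasurableSpace Ω} (hm₀ : m₀ ≤ m) {s : Set Ω} :
    MeasurableSet[augment μ m₀] s ↔
      MeasurableSet[m] s ∧ ∃ t, MeasurableSet[m₀] t ∧ μ (s ∆ t) = 0 := by
  constructor
  · have hle : augment μ m₀ ≤ almostSpace μ m₀ := by
      refine sup_le (fun t ht ↦ ⟨hm₀ t ht, t, ht, by simp⟩) (MeasurableSpace.generateFrom_le ?_)
      rintro u ⟨hu, hu0⟩
      exact ⟨hu, ∅, @MeasurableSet.empty Ω m₀, by simpa using hu0⟩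
    exact fun hs ↦ hle s hs
  · rintro ⟨hs, t, ht, hst⟩
    have ht' : MeasurableSet[m] t := hm₀ t ht
    have hts : μ (t \ s) = 0 := measure_mono_null (fun x hx ↦ Or.inr hx) hst
    have hst' : μ (s \ t) = 0 := measure_mono_null (fun x hx ↦ Or.inl hx) hst
    have hgen : ∀ u, MeasurableSet[m] u → μ u = 0 → MeasurableSet[augment μ m₀] u :=
      fun u hu hu0 ↦ @le_sup_right (MeasurableSpace Ω) _ m₀ (nullSigma μ) u
        (MeasurableSpace.measurableSet_generateFrom ⟨hu, hu0⟩)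
    have h1 : MeasurableSet[augment μ m₀] (t \ s) := hgen _ (ht'.diff hs) hts
    have h2 : MeasurableSet[augment μ m₀] (s \ t) := hgen _ (hs.diff ht') hst'
    have h3 : MeasurableSet[augment μ m₀] t := le_augment μ m₀ t ht
    have hdec : s = (t \ (t \ s)) ∪ (s \ t) := by
      ext x
      simp only [mem_union, Set.mem_sdiff]
      by_cases hxs : x ∈ s <;> by_cases hxt : x ∈ t <;> simp [hxs, hxt]
    rw [hdec]
    exact (h3.diff h1).union h2

variable {μ}

/-- **Conditional expectations are unchanged by augmentation**: for a finite measure, `m₀ ≤ m`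
and integrable `g`, `μ[g | augment μ m₀] =ᵐ[μ] μ[g | m₀]`. [cite: Kallenberg2021, Lemma 9.8] -/
theorem condExp_augment_ae_eq [IsFiniteMeasure μ] {m₀ : MeasurableSpace Ω} (hm₀ : m₀ ≤ m)
    {E : Type*} [NormedAddCommGroup E] [NormedSpace ℝ E] [CompleteSpace E] {g : Ω → E}
    (hg : Integrable g μ) : μ[g|augment μ m₀] =ᵐ[μ] μ[g|m₀] := by
  have haug : augment μ m₀ ≤ m := augment_le μ hm₀
  haveI : IsFiniteMeasure (μ.trim haug) := isFiniteMeasure_trim haug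
  symm
  refine ae_eq_condExp_of_forall_setIntegral_eq haug hg
    (fun s _ _ ↦ integrable_condExp.integrableOn) (fun s hs _ ↦ ?_) ?_
  · obtain ⟨-, t, ht, hst⟩ := (measurableSet_augment_iff μ hm₀).1 hs
    have hae : s =ᵐ[μ] t := measure_symmDiff_eq_zero_iff.1 hst
    rw [setIntegral_congr_set hae, setIntegral_congr_set hae]
    exact setIntegral_condExp hm₀ hg ht
  · exact (stronglyMeasurable_condExp.mono (le_augment μ m₀)).aestronglyMeasurable

/-- **A.e. equality transfers measurability to the augmentation**: if `f` is measurable,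
`g` is `m₀`-measurable and `f = g` `μ`-a.e., then `f` is `augment μ m₀`-measurable.
[cite: Kallenberg2021, Lemma 9.8] -/
theorem measurable_augment_of_ae_eq {m₀ : MeasurableSpace Ω} (hm₀ : m₀ ≤ m) {β : Type*}
    [MeasurableSpace β] {f g : Ω → β} (hf : Measurable[m] f) (hg : Measurable[m₀] g)
    (hfg : f =ᵐ[μ] g) : Measurable[augment μ m₀] f := by
  intro B hB
  have hnull : μ {x | f x ≠ g x} = 0 := by
    have := hfg
    rw [Filter.EventuallyEq, ae_iff] at this
    exact this
  obtain ⟨N, hN, -, hN0⟩ := @exists_measurable_superset_of_null Ω m μ _ hnull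
  refine (measurableSet_augment_iff μ hm₀).2 ⟨hf hB, g ⁻¹' B, hg hB, measure_mono_null ?_ hN0⟩
  intro x hx
  apply hN
  rcases hx with ⟨h1, h2⟩ | ⟨h1, h2⟩
  · intro h; exact h2 (show g x ∈ B by rw [← h]; exact h1)
  · intro h; exact h2 (show f x ∈ B by rw [h]; exact h1)

/-! ### The augmented filtration -/

variable {ι : Type*} [Preorder ι]

variable (μ) in
/-- **The augmented filtration** `n ↦ 𝒢 n ⊔ nullSigma μ`. [cite: Kallenberg2021, Lemma 9.8] -/
def filtration (𝒢 : Filtration ι m) : Filtration ι m where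
  seq n := augment μ (𝒢 n)
  mono' _ _ hij := sup_le_sup_right (𝒢.mono hij) _
  le' n := augment_le μ (𝒢.le n)

/-- The augmented filtration at `n` is `augment μ (𝒢 n)`. [folklore] -/
@[simp] theorem filtration_apply (𝒢 : Filtration ι m) (n : ι) :
    filtration μ 𝒢 n = augment μ (𝒢 n) := rfl

/-- The augmented filtration dominates the original one. [folklore] -/
theorem le_filtration (𝒢 : Filtration ι m) (n : ι) : 𝒢 n ≤ filtration μ 𝒢 n :=
  le_augment μ _

/-- Adapted processes stay adapted. [folklore] -/
theorem adapted_filtration {𝒢 : Filtration ι m} {β : ι → Type*} [∀ i, MeasurableSpace (β i)]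
    {u : (i : ι) → Ω → β i} (hu : Adapted 𝒢 u) : Adapted (filtration μ 𝒢) u :=
  fun n ↦ (hu n).mono (le_filtration 𝒢 n) le_rfl

/-- Stopping times stay stopping times. [folklore] -/
theorem isStoppingTime_filtration {𝒢 : Filtration ι m} {τ : Ω → WithTop ι}
    (hτ : IsStoppingTime 𝒢 τ) : IsStoppingTime (filtration μ 𝒢) τ :=
  fun n ↦ le_filtration 𝒢 n _ (hτ n)

/-- **Locality up to null sets becomes sure locality**: if the ambient-measurable `f` agrees
`μ`-a.e. with a `𝒢 n`-measurable function, it is measurable for the augmented filtration at `n`.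
[cite: Kallenberg2021, Lemma 9.8] -/
theorem measurable_filtration_of_ae_eq {𝒢 : Filtration ι m} {n : ι} {β : Type*}
    [MeasurableSpace β] {f g : Ω → β} (hf : Measurable[m] f) (hg : Measurable[𝒢 n] g)
    (hfg : f =ᵐ[μ] g) : Measurable[filtration μ 𝒢 n] f :=
  measurable_augment_of_ae_eq (𝒢.le n) hf hg hfg

/-- **Conditional expectations given the augmented filtration** agree a.e. with those given the
original one. [cite: Kallenberg2021, Lemma 9.8] -/
theorem condExp_filtration_ae_eq [IsFiniteMeasure μ] (𝒢 : Filtration ι m) {E : Type*}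
    [NormedAddCommGroup E] [NormedSpace ℝ E] [CompleteSpace E] {g : Ω → E} (hg : Integrable g μ)
    (n : ι) : μ[g|filtration μ 𝒢 n] =ᵐ[μ] μ[g|𝒢 n] :=
  condExp_augment_ae_eq (𝒢.le n) hg

end Augment

/-- **Augmentation by null sets does not change conditional expectations** (registered glue form,
with the augmentation `m₀ ⊔ σ(null sets)` spelled out): for a finite measure `μ`, a sub-σ-algebra
`m₀ ≤ m` and an integrable `g`, `μ[g | m₀ ⊔ σ{N measurable, μ N = 0}] = μ[g | m₀]` a.e.
[cite: Kallenberg2021, Lemma 9.8] -/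
theorem slitCrossing_condExp_augment_ae_eq : ∀ {Ω : Type*} {m : MeasurableSpace Ω} (μ : MeasureTheory.Measure Ω) [MeasureTheory.IsFiniteMeasure μ] {m₀ : MeasurableSpace Ω}, m₀ ≤ m → ∀ {E : Type*} [NormedAddCommGroup E] [NormedSpace ℝ E] [CompleteSpace E] {g : Ω → E}, MeasureTheory.Integrable g μ → μ[g|m₀ ⊔ MeasurableSpace.generateFrom {s | MeasurableSet[m] s ∧ μ s = 0}] =ᵐ[μ] μ[g|m₀] := by
  intro Ω m μ _ m₀ hm₀ E _ _ _ g hg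
  exact Augment.condExp_augment_ae_eq hm₀ hg

end Summit.CriticalPhenomena.CardyFormulaZ2.Cruxes.CardyRigidity.CrossingMartingale

end
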